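import Summits.HubbardSuperconductivity.HubbardSuperconductivity.Theses.LiebTwin
import Summits.HubbardSuperconductivity.HubbardSuperconductivity.Theorems.DWavePolarisedDiscordance.Negative.StubMassFeedsBondSingletsFalseWithoutMinimality

/-!
# Disproof of `DWavePolarisedDiscordance` (K3′, stmt-HubbardSuperconductivity-15314, route `LiebTwin`) —
# findings of the standing disprover (cdisprove, cycle 1, 2026-08-17)

Crux (fixed): `∀ (U,δ) ∈ (0,4]×[1/10,3/10] ∃ κ>0 ∀ ε>0, ev. in even L, ∀ unit (N_L,0)-sector GS φ of
hubbardTorus 2 L 1 U: κ·(F_s(φ̃) − F_s(φ)) − εL⁴ ≤ F_d(φ) − F_d(φ̃)`, `φ̃ = liebVec n (CFC.abs (liebW n φ))`,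
`F_g(χ) = Re⟨χ, Δ_gᴴΔ_g χ⟩`. Write `m = F_s(φ̃) − F_s(φ)` (discordance mass), `D = F_d(φ)`, `D′ = F_d(φ̃)`.

## Verdict so far: NO KILL — and why it resists
An unconditional `¬K3′` needs the SIGN and SIZE of `D − D′` versus `m` for ground states of the doped repulsive
torus at infinitely many `L` (the statement is `∃L₀`-asymptotic, so no finite computation refutes it, and the
symmetries — translations, `D₄`, spin flip, `SU(2)`, conjugation — give no magnitudes; the twin map is
phase-invariant and equivariant). Nothing in the tree or in print controls these (census STRATEGY-CENSUS.md,
ATTACK.md concur). All refutable content found is about WHICH HYPOTHESIS carries the statement: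

## (a) Load-bearing analysis — LANDED: `Theorems/DWavePolarisedDiscordance/Negative/`
## `EtaTowerDoublonSums` (p156314) → `StaggeredTowerOrders` (p156552) → `FalseWithoutMinimality` (p156766);
## axioms propext/choice/Quot.sound
`dWavePolarisedDiscordance_false_without_minimality : ¬ DWavePolarisedDiscordanceWithoutMinimality` —
keep EVERY clause of K3′ (box, quantifiers, even L, normalisation, joint sector, φ ≠ 0, and the eigenvector
equation Hφ = Eφ) and drop ONLY "E is the lowest energy of the sector": FALSE. Witness: the normalised
STAGGERED η-tower `φ_L ∝ (η_π†)^n|0⟩ = etaPairingState torusStagger n` (Yang's exact eigenstate, energy nU,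
sector (n,n), real, Lieb matrix `W = n!·diag(±1)` symmetric ⇒ flip-definite). Then `|W| = n!·1`, the twin is the
UNSTAGGERED doublon condensate, `F_s(φ̃) = 2n(L²−n+1)` (Yang's MAXIMUM) while `F_s(φ) = 2(n − L²Y) ≤ 2n`, so
`m ≥ 2n(L²−n) ≍ (15/32)L⁴` (maximal discordance); but `D = D′` EXACTLY (a bond pair field, `g 0 = 0`, acts on
doublon sums with disjoint supports, so its order depends only on |weights|). `κm − (κ/8)L⁴ ≤ 0` fails at every
even L ≥ 2. READING: K3′ is carried 100% by the variational/bottom-of-spectrum property; eigen-equation + sector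
+ reality/flip-definiteness + symmetry cannot prove it; the η_π-tower is the extremal discordant state (maximal
mass, zero d-moment) that a proof must exclude QUANTITATIVELY for ground states (energetically it sits nU above
the doublon-free competition — that is the only lever).

## (b) Other hypotheses (not falsifiable by dropping; recorded for the provers)
* `U ∈ (0,4]`: at U < 0 every sector GS is its own twin (Lieb), K3′ reads `−εL⁴ ≤ 0` (strategist's
  `siblingK3_vacuous`); at U = 0 open-shell differences are O(L²) — K3′ trivially true. So "U > 0" is where the
  content lives but dropping it does not falsify.
* normalisation: both sides are 2-homogeneous in φ; it matters only through the εL⁴ slack.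
* `Even L`, `L ≥ L₀`: at L = 2 (n = 1) the d-amplitude of ANY translation/C₄-symmetric sector state is a
  rotation-odd LINEAR functional ⇒ D = D′ = 0 while m > 0 for the 2-electron repulsive GS (W indefinite:
  g_{k=0} > 0 > g_{k≠0}); so K3′ needs L₀ ≥ 4 — a `_false_without_eventually` lemma would need the exact
  2-electron GS of the 2×2 torus in Lean (not attempted: low guidance value).
* rev-1 typing hole (complex members of degenerate multiplets, census N4): no structural degeneracy is forced
  along L (momentum/SU(2)/conjugation give none generically provable), so no refutation handle.

## (c) Natural strengthenings refuted
* the all-states / all-eigenstates (operator) form of K3′: FALSE — (a) above (strictly stronger than the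
  census's kinematic n = 1 witness N1: the witness is an exact eigenstate in the crux's own sector at every L).

## (d) Targets (lead's stubs, line `registered`): none stuck (`stuck_stubs = []`); the line is certified vacuous by
the lead (stub 1 ≡ K3″ ⇐ K3′, p147389) and K3′ := K3″ is the recommended restatement. LANDED for that stub:
`Negative.stub_massFeedsBondSinglets_false_without_minimality` (file
`Negative/StubMassFeedsBondSingletsFalseWithoutMinimality.lean`; toolkit `Negative/BondOrderDoublonBound.lean`,
p157587): K3″ (`κm − εL⁴ ≤ D + X`) VERBATIM with the GS clause weakened to "sector eigenvector" is FALSE too —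
the staggered tower has maximal mass while ALL its bond pair orders are O(n) = O(L²)
(`F_g(φ) ≤ 2C_g² n` for every bond form factor: at most two local pair operators feed an amplitude of a doublon
configuration). So the locality bet of K3″ is, like K3′, purely a GROUND-state statement (variational input needed).

## (e) Numerics (lead's 4×4 ED, line-registered.pub.md): (N=6,U=4): (D−D′)/m = −0.240; (N=10,U=1) [box corner
δ=0.3 at L=4]: m = 4.566, D = 31.741 < D′ = 31.771, (D−D′)/m = −0.0066 < 0 — the crux ratio is NEGATIVE in both
repulsive ground states computed so far (K3′ "fails" at L = 4 for every κ; asymptotics untouched); N=12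
(δ=1/4), N=14 (δ=1/8) pending (j024958/j024961).
-/

-- the mandated namespace repeats `HubbardSuperconductivity` (single-problem summit, D-0017)
set_option linter.dupNamespace false

namespace Summit.HubbardSuperconductivity.HubbardSuperconductivity.Cruxes.DWavePolarisedDiscordance.Disproof

open Matrix Literature.MathematicalPhysics.QuantumLattice
open scoped MatrixOrder Matrix.Norms.L2Operator

/-- **K3′ with the bottom-of-spectrum clause dropped.** VERBATIM the crux
`Theses.LiebTwin.DWavePolarisedDiscordance`, except that `IsGroundStateInSector (hubbardTorus 2 L 1 U) (2n) 0 φ`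
(`= φ ∈ szSector (2n) 0 ∧ φ ≠ 0 ∧ Hφ = (minEnergyOn …)•φ`) is replaced by "nonzero sector EIGENVECTOR"
(`∃ E, Hφ = E•φ`). Every sector ground state satisfies the new hypothesis, so this statement implies the crux.
[folklore] -/
def DWavePolarisedDiscordanceWithoutMinimality : Prop :=
  ∀ U ∈ Set.Ioc (0 : ℝ) 4, ∀ δ ∈ Set.Icc (1 / 10 : ℝ) (3 / 10), ∃ κ : ℝ, 0 < κ ∧ ∀ ε : ℝ, 0 < ε →
    ∃ L₀ : ℕ, ∀ (L : ℕ) [NeZero L], L₀ ≤ L → Even L → ∀ φ : Fock (Orb (FermionTorus 2 L)),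
      star φ ⬝ᵥ φ = 1 →
      (φ ∈ szSector (Λ := FermionTorus 2 L) (2 * ⌊(1 - δ) * (L : ℝ) ^ 2 / 2⌋₊) 0 ∧ φ ≠ 0 ∧
          ∃ E : ℝ, hubbardTorus 2 L 1 U *ᵥ φ = (E : ℂ) • φ) →
      κ * ((expect ((pairField sWave L)ᴴ * pairField sWave L)
              (liebVec ⌊(1 - δ) * (L : ℝ) ^ 2 / 2⌋₊
                (CFC.abs (liebW ⌊(1 - δ) * (L : ℝ) ^ 2 / 2⌋₊ φ)))).re -
            (expect ((pairField sWave L)ᴴ * pairField sWave L) φ).re) - ε * (L : ℝ) ^ 4 ≤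
        (expect ((pairField dWaveFormFactor L)ᴴ * pairField dWaveFormFactor L) φ).re -
          (expect ((pairField dWaveFormFactor L)ᴴ * pairField dWaveFormFactor L)
            (liebVec ⌊(1 - δ) * (L : ℝ) ^ 2 / 2⌋₊
              (CFC.abs (liebW ⌊(1 - δ) * (L : ℝ) ^ 2 / 2⌋₊ φ)))).re

/-- The weakened statement implies the crux (a ground state is a sector eigenvector): so
`dWavePolarisedDiscordance_false_without_minimality` below is a genuine LOAD-BEARING statement — any proof of
K3′ must use `minEnergyOn`. [folklore] -/
theorem dWavePolarisedDiscordance_of_withoutMinimality (h : DWavePolarisedDiscordanceWithoutMinimality) :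
    Summit.HubbardSuperconductivity.HubbardSuperconductivity.Theses.LiebTwin.DWavePolarisedDiscordance := by
  intro U hU δ hδ
  obtain ⟨κ, hκ, h⟩ := h U hU δ hδ
  refine ⟨κ, hκ, fun ε hε => ?_⟩
  obtain ⟨L₀, h⟩ := h ε hε
  exact ⟨L₀, fun L _ hL hE φ hφ hgs => h L hL hE φ hφ ⟨hgs.1, hgs.2.1, _, hgs.2.2⟩⟩

/-- **ANY PROOF OF K3′ MUST USE THE BOTTOM-OF-SPECTRUM CLAUSE** (landed:
`Theorems.DWavePolarisedDiscordance.Negative.dWavePolarisedDiscordance_false_without_minimality`, p156766; toolkit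
p156314, p156552). Witness and mechanism: module docstring §(a). [folklore] -/
theorem dWavePolarisedDiscordance_false_without_minimality : ¬ DWavePolarisedDiscordanceWithoutMinimality :=
  Summit.HubbardSuperconductivity.HubbardSuperconductivity.Theorems.DWavePolarisedDiscordance.Negative.dWavePolarisedDiscordance_false_without_minimality

/-- **(c) The all-states (operator / kinematic) form of K3′ is false a fortiori**: quantifying over every unit
vector of the joint sector (no spectral condition at all) is stronger than the eigenvector form refuted above.
(Census S⁺_A / N1 made a theorem; the witness is the same staggered tower.) [folklore] -/
theorem dWavePolarisedDiscordance_false_allStates :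
    ¬ (∀ U ∈ Set.Ioc (0 : ℝ) 4, ∀ δ ∈ Set.Icc (1 / 10 : ℝ) (3 / 10), ∃ κ : ℝ, 0 < κ ∧ ∀ ε : ℝ, 0 < ε →
        ∃ L₀ : ℕ, ∀ (L : ℕ) [NeZero L], L₀ ≤ L → Even L → ∀ φ : Fock (Orb (FermionTorus 2 L)),
          star φ ⬝ᵥ φ = 1 →
          φ ∈ szSector (Λ := FermionTorus 2 L) (2 * ⌊(1 - δ) * (L : ℝ) ^ 2 / 2⌋₊) 0 →
          κ * ((expect ((pairField sWave L)ᴴ * pairField sWave L)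
                  (liebVec ⌊(1 - δ) * (L : ℝ) ^ 2 / 2⌋₊
                    (CFC.abs (liebW ⌊(1 - δ) * (L : ℝ) ^ 2 / 2⌋₊ φ)))).re -
                (expect ((pairField sWave L)ᴴ * pairField sWave L) φ).re) - ε * (L : ℝ) ^ 4 ≤
            (expect ((pairField dWaveFormFactor L)ᴴ * pairField dWaveFormFactor L) φ).re -
              (expect ((pairField dWaveFormFactor L)ᴴ * pairField dWaveFormFactor L)
                (liebVec ⌊(1 - δ) * (L : ℝ) ^ 2 / 2⌋₊
                  (CFC.abs (liebW ⌊(1 - δ) * (L : ℝ) ^ 2 / 2⌋₊ φ)))).re) := by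
  intro h
  refine dWavePolarisedDiscordance_false_without_minimality fun U hU δ hδ => ?_
  obtain ⟨κ, hκ, h⟩ := h U hU δ hδ
  refine ⟨κ, hκ, fun ε hε => ?_⟩
  obtain ⟨L₀, h⟩ := h ε hε
  exact ⟨L₀, fun L _ hL hE φ hφ hyp => h L hL hE φ hφ hyp.1⟩

/-- **(d) K3″ (stub `stub_massFeedsBondSinglets`) without the bottom-of-spectrum clause is false** (landed:
`Negative.stub_massFeedsBondSinglets_false_without_minimality`). [folklore] -/
theorem stub_massFeedsBondSinglets_false_without_minimality :
    ¬ (∀ U ∈ Set.Ioc (0 : ℝ) 4, ∀ δ ∈ Set.Icc (1 / 10 : ℝ) (3 / 10), ∃ κ : ℝ, 0 < κ ∧ ∀ ε : ℝ, 0 < ε →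
        ∃ L₀ : ℕ, ∀ (L : ℕ) [NeZero L], L₀ ≤ L → Even L → ∀ φ : Fock (Orb (FermionTorus 2 L)),
          star φ ⬝ᵥ φ = 1 →
          (φ ∈ szSector (Λ := FermionTorus 2 L) (2 * ⌊(1 - δ) * (L : ℝ) ^ 2 / 2⌋₊) 0 ∧ φ ≠ 0 ∧
              ∃ E : ℝ, hubbardTorus 2 L 1 U *ᵥ φ = (E : ℂ) • φ) →
          κ * ((expect ((pairField sWave L)ᴴ * pairField sWave L)
                  (liebVec ⌊(1 - δ) * (L : ℝ) ^ 2 / 2⌋₊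
                    (CFC.abs (liebW ⌊(1 - δ) * (L : ℝ) ^ 2 / 2⌋₊ φ)))).re -
                (expect ((pairField sWave L)ᴴ * pairField sWave L) φ).re) - ε * (L : ℝ) ^ 4 ≤
            (expect ((pairField dWaveFormFactor L)ᴴ * pairField dWaveFormFactor L) φ).re +
              (expect ((pairField extendedSWave L)ᴴ * pairField extendedSWave L) φ).re) :=
  Summit.HubbardSuperconductivity.HubbardSuperconductivity.Theorems.DWavePolarisedDiscordance.Negative.stub_massFeedsBondSinglets_false_without_minimality

/-! **(b) The extremal discordant state, for the provers** — see the landed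
`Summit.HubbardSuperconductivity.HubbardSuperconductivity.Theorems.DWavePolarisedDiscordance.Negative.staggeredTower_rectification_orders`
(file `Theorems/DWavePolarisedDiscordance/Negative/FalseWithoutMinimality.lean`): on the even torus of side `L ≥ 2`,
`1 ≤ n ≤ L²`, the normalised staggered tower `φ = c(η_π†)^n|0⟩` is an `(n,n)`-sector eigenvector of
`hubbardTorus 2 L t U` (energy `nU`), its twin attains Yang's maximum `F_s(φ̃) = 2n(L²-n+1)`, `F_s(φ) ≤ 2n`, and
`F_g(φ̃) = F_g(φ)` for every bond form factor (`g 0 = 0`). Any quantitative route to K3′ must beat this state by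
ENERGY (it sits `nU` above the doublon-free competition). Toolkit for variants (K3″ etc.):
`Negative/EtaTowerDoublonSums.lean` (doublon sums, disjoint supports), `Negative/StaggeredTowerOrders.lean`. -/

end Summit.HubbardSuperconductivity.HubbardSuperconductivity.Cruxes.DWavePolarisedDiscordance.Disproof
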